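import Summits.QuantumFields.YangMills.Theorems.UV3PinnedLargeFieldResummation
import HarnessLib

/-!
# R3 (cell `ym3-torus`, YM₃ on T³ — a ladder RUNG, NOT d = 4, NOT the Clay problem), UV3-node side of R-19936-S ∕ R-19936-U —
# **THE LARGE-FIELD RESUMMATION OF [Balaban1985UV3] (41) ∕ [9] §3.C AT ONE LEVEL, FOR MASSES UNDER AN ENVELOPE, ADMISSIBLE HISTORIES ONLY,
# UN-PINNED AND WITH ONE LARGE-FIELD PLAQUETTE PINNED** (generic, finitary; the `HistModel.dominated` field of lit `B10LargeFieldSum` REPLACED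
# by an explicit mass envelope `m ≤ Menv·exp(A₀·Σ_j |Z_j|)`)

Seat `ym-ust-19936-w6` g7 (R526 (S) hand; LOCATE `LOCATE-S-ORGAN-w6g7.md`, 19936 evidence #60, row T4).  THEOREMS ONLY (0 `def`, 0 `sorry`);
`--supports stmt-QuantumFields-19936 --as helper`; count-neutral.

WHY.  The organ rows of R-19936-S (`hSii`, the (41)_K history sum of the AC tower RESTRICTED to the histories through one pinned plaquette, a.e.; `ym3-torus-px8` g11's
(S-KNIT)) and of R-19936-U (`hlf`, the un-pinned sum; ✓`UV3UnitEnvelopeFaceOfPackageV3`) are both instances of the model-independent resummation of pp. 273–274.  The tree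
holds it for a `HistModel` (lit ✓`B10LargeFieldSum.largeFieldControl_of_resummation`, pinned twin ✓`UV3PinnedLargeFieldResummation.largeField_pinned_of_resummation`) whose
ONLY mass fact is the field `dominated`, closed in the lane by `mass ≤ 1` (`Carriers.Histories.lf_dominated`) — which the AC tower's exact Radon–Nikodym masses
(`MassesAC.massRecAC`, `MassesPAC.massRecP`) do not offer pointwise.  THIS FILE re-types the SAME interior (lit `perSource_net_le`, `exchange_sum`, `scaleEntropy_sum_le`,
`sum_powerset_exp_sum_le`) over EXPLICIT finitary data at one level — a finite history family with real masses `m` that VANISH off the admissible histories and obey an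
ENVELOPE `m ≤ Menv·exp(A₀·Σ_{j<k} zvol_j(disc h))` on the admissible ones, an injective large-field record `disc`, the small factors (67)–(71) on ADMISSIBLE histories only
(as in the lane's `LargeFieldKnitAdm`), the volume terms (41)∕(66) and the counted collar cover (39) — so that the AC tower at the unit lattice can be fed with an a.e. mass
ENVELOPE (the displayed row hJ of the LOCATE) in place of `mass ≤ 1`.
* §1 finitary: `sum_powerset_ite_mem_exp_sum_eq`∕`_le` (the {P_j}-resummation split EXACTLY along one pinned candidate), `sum_mul_exp_le_of_envelope`∕`_pinned`
  (domination of `Σ_h m_h e^{Φ_h}` by the powerset sums through the envelope and the injectivity of `disc` on admissible histories).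
* §2 interior: `net_exponent_le` (per discrete history, lit `perSource_net_le`), `exp_theta_le`, `sum_exp_theta_le` (`Σ_E e^{θ} ≤ (3∕ℓ)S`, lit `scaleEntropy_sum_le`).
* §3 ★★★ `largeField_enveloped_adm` — (U) `Σ_h m_h·exp(−mainT_h + Zterm_h) ≤ Menv·exp((3∕ℓ)S)` and (P) for a family through `e₀ ∈ E`:
  `≤ Menv·exp(−(c₁∕8)·p(g_{e₀.1})²)·exp((3∕ℓ)S)` — EXACTLY the hypotheses of lit ✓`largeFieldControl_of_resummation` with the `HistModel` fields spelled out as functions.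

HONEST SCOPE.  Finitary bookkeeping (re-derived interior of the lit theorem); it does not produce the small factors, the envelope, the collar count or the carrier; nothing of
`hSii`, `hlf`, `stub_pinnedStep`, `stub_unitEnvelope`, `HistoryTailL` (19936), the rung, d = 4, a mass gap or Clay is proved here.

References: T. Bałaban, *Ultraviolet stability of three-dimensional lattice pure gauge field theories*, Commun. Math. Phys. **102** (1985) 255–275 [Balaban1985UV3]
((41) p. 266, (39) p. 266, (67)–(71) p. 273, pp. 273–274, (7) p. 257); T. Bałaban, *(Higgs)₂,₃ quantum fields in a finite volume. II*, Commun. Math. Phys. **86** (1982)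
555–594 [Balaban1982Higgs2] (§3.C).
-/

set_option autoImplicit false

namespace Summit.QuantumFields.YangMills.Theorems.UV3LargeFieldEnvelopedResummation

open scoped BigOperators
open Literature.MathematicalPhysics.QuantumFieldTheory.Balaban1983to89
open Literature.MathematicalPhysics.QuantumFieldTheory.Balaban1983to89.B10LargeField (xlog one_le_xlog pFun_eq)
open Literature.MathematicalPhysics.QuantumFieldTheory.Balaban1983to89.B10LargeFieldSum
  (sum_powerset_exp_sum_le exchange_sum perSource_net_le scaleEntropy_sum_le)

/-! ## §1 Finitary resummation with one candidate pinned, and domination through a mass envelope -/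

section Finitary

variable {β : Type*} [DecidableEq β]

/-- ★ **THE {P_j}-RESUMMATION SPLIT ALONG ONE CANDIDATE, EXACTLY.**  For a finite candidate set `E ∋ e₀` and per-candidate exponents `θ`:
`Σ_{Q ⊆ E} 𝟙[e₀ ∈ Q]·exp(Σ_{e∈Q} θ_e) = exp(θ_{e₀}) · Σ_{Q ⊆ E∖e₀} exp(Σ_{e∈Q} θ_e)` (`Finset.sum_powerset_insert` on `E = insert e₀ (E.erase e₀)`).
[cite: Balaban1985UV3, (8) p.258, pp.273–274] -/
theorem sum_powerset_ite_mem_exp_sum_eq (E : Finset β) (θ : β → ℝ) {e₀ : β} (he₀ : e₀ ∈ E) :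
    ∑ Q ∈ E.powerset, (if e₀ ∈ Q then Real.exp (∑ e ∈ Q, θ e) else 0)
      = Real.exp (θ e₀) * ∑ Q ∈ (E.erase e₀).powerset, Real.exp (∑ e ∈ Q, θ e) := by
  set s : Finset β := E.erase e₀ with hs
  have hEs : E = insert e₀ s := (Finset.insert_erase he₀).symm
  have he₀s : e₀ ∉ s := Finset.notMem_erase e₀ E
  rw [hEs, Finset.sum_powerset_insert he₀s]
  have h1 : ∑ Q ∈ s.powerset, (if e₀ ∈ Q then Real.exp (∑ e ∈ Q, θ e) else 0) = 0 := by
    refine Finset.sum_eq_zero fun Q hQ => ?_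
    have hQ' : e₀ ∉ Q := fun h => he₀s (Finset.mem_powerset.mp hQ h)
    rw [if_neg hQ']
  have h2 : ∑ Q ∈ s.powerset, (if e₀ ∈ insert e₀ Q then Real.exp (∑ e ∈ insert e₀ Q, θ e) else 0)
      = Real.exp (θ e₀) * ∑ Q ∈ s.powerset, Real.exp (∑ e ∈ Q, θ e) := by
    rw [Finset.mul_sum]
    refine Finset.sum_congr rfl fun Q hQ => ?_
    have hQ' : e₀ ∉ Q := fun h => he₀s (Finset.mem_powerset.mp hQ h)
    rw [if_pos (Finset.mem_insert_self e₀ Q), Finset.sum_insert hQ', Real.exp_add]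
  rw [h1, h2, zero_add]

/-- ★ **ONE PINNED CANDIDATE KEEPS ITS FACTOR IN FRONT OF THE RESUMMATION**: `Σ_{Q ⊆ E} 𝟙[e₀ ∈ Q]·exp(Σ_Q θ) ≤ exp(θ_{e₀})·exp(Σ_{e∈E} e^{θ_e})`
(§1's split, then lit ✓`sum_powerset_exp_sum_le` on `E∖e₀` and monotonicity). [cite: Balaban1985UV3, (8) p.258, pp.273–274; Balaban1982Higgs2, §3.C] -/
theorem sum_powerset_ite_mem_exp_sum_le (E : Finset β) (θ : β → ℝ) {e₀ : β} (he₀ : e₀ ∈ E) :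
    ∑ Q ∈ E.powerset, (if e₀ ∈ Q then Real.exp (∑ e ∈ Q, θ e) else 0)
      ≤ Real.exp (θ e₀) * Real.exp (∑ e ∈ E, Real.exp (θ e)) := by
  rw [sum_powerset_ite_mem_exp_sum_eq E θ he₀]
  refine mul_le_mul_of_nonneg_left ?_ (Real.exp_pos _).le
  refine (sum_powerset_exp_sum_le (E.erase e₀) θ).trans (Real.exp_le_exp.mpr ?_)
  exact Finset.sum_le_sum_of_subset_of_nonneg (Finset.erase_subset e₀ E) fun e _ _ => (Real.exp_pos _).le

variable {ι : Type*}

/-- The common first step of the two dominations: drop the inadmissible histories (mass `0`), bound each admissible term through the envelope and the bounding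
function, and re-index by the (injective) discrete data. [cite: Balaban1985UV3, (41) p.266] -/
theorem sum_mul_exp_le_sum_image (H : Finset ι) (adm : ι → Prop) [DecidablePred adm] (disc : ι → Finset β)
    (hinj : Set.InjOn disc {h | h ∈ H ∧ adm h}) (m Φ : ι → ℝ) (B ζ : Finset β → ℝ) {Menv : ℝ} (hMenv : 0 ≤ Menv)
    (hm_adm : ∀ h ∈ H, ¬ adm h → m h = 0) (hmE : ∀ h ∈ H, adm h → m h ≤ Menv * Real.exp (ζ (disc h)))
    (hΦ : ∀ h ∈ H, adm h → Φ h ≤ B (disc h)) :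
    ∑ h ∈ H, m h * Real.exp (Φ h) ≤ ∑ Q ∈ (H.filter adm).image disc, Menv * Real.exp (B Q + ζ Q) := by
  classical
  have hinj' : Set.InjOn disc ↑(H.filter adm) := by
    intro a ha b hb hab
    rw [Finset.coe_filter] at ha hb
    exact hinj ha hb hab
  rw [Finset.sum_image hinj', ← Finset.sum_filter_add_sum_filter_not H adm]
  have hz : ∑ h ∈ H.filter (fun h => ¬ adm h), m h * Real.exp (Φ h) = 0 :=
    Finset.sum_eq_zero fun h hh => by
      rw [Finset.mem_filter] at hh
      rw [hm_adm h hh.1 hh.2, zero_mul]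
  rw [hz, add_zero]
  refine Finset.sum_le_sum fun h hh => ?_
  rw [Finset.mem_filter] at hh
  calc m h * Real.exp (Φ h) ≤ (Menv * Real.exp (ζ (disc h))) * Real.exp (B (disc h)) :=
        mul_le_mul (hmE h hh.1 hh.2) (Real.exp_le_exp.mpr (hΦ h hh.1 hh.2)) (Real.exp_pos _).le
          (mul_nonneg hMenv (Real.exp_pos _).le)
    _ = Menv * Real.exp (B (disc h) + ζ (disc h)) := by rw [Real.exp_add]; ring

/-- ★ **DOMINATION THROUGH A MASS ENVELOPE (un-pinned).**  On a finite family of histories with real masses `m` vanishing off the admissible ones, an injective (on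
admissible histories) record `disc h ⊆ E`, an envelope `m_h ≤ Menv·exp(ζ(disc h))` and exponents `Φ_h ≤ B(disc h)` on admissible `h`:
`Σ_h m_h·e^{Φ_h} ≤ Menv·Σ_{Q ⊆ E} exp(B Q + ζ Q)` — the `dominated` inequality of lit `B10LargeFieldSum.HistModel` with the mass allowance made explicit.
[cite: Balaban1985UV3, (41) p.266, pp.267–268] -/
theorem sum_mul_exp_le_of_envelope (H : Finset ι) (E : Finset β) (adm : ι → Prop) [DecidablePred adm] (disc : ι → Finset β)
    (hdiscE : ∀ h ∈ H, adm h → disc h ⊆ E) (hinj : Set.InjOn disc {h | h ∈ H ∧ adm h})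
    (m Φ : ι → ℝ) (B ζ : Finset β → ℝ) {Menv : ℝ} (hMenv : 0 ≤ Menv)
    (hm_adm : ∀ h ∈ H, ¬ adm h → m h = 0)
    (hmE : ∀ h ∈ H, adm h → m h ≤ Menv * Real.exp (ζ (disc h)))
    (hΦ : ∀ h ∈ H, adm h → Φ h ≤ B (disc h)) :
    ∑ h ∈ H, m h * Real.exp (Φ h) ≤ Menv * ∑ Q ∈ E.powerset, Real.exp (B Q + ζ Q) := by
  classical
  refine (sum_mul_exp_le_sum_image H adm disc hinj m Φ B ζ hMenv hm_adm hmE hΦ).trans ?_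
  rw [Finset.mul_sum]
  refine Finset.sum_le_sum_of_subset_of_nonneg ?_ fun Q _ _ => mul_nonneg hMenv (Real.exp_pos _).le
  intro Q hQ
  obtain ⟨h, hh, rfl⟩ := Finset.mem_image.mp hQ
  rw [Finset.mem_filter] at hh
  exact Finset.mem_powerset.mpr (hdiscE h hh.1 hh.2)

/-- ★★ **DOMINATION THROUGH A MASS ENVELOPE, ONE CANDIDATE PINNED.**  As `sum_mul_exp_le_of_envelope`, for a family `H` of histories THROUGH `e₀` (`adm h → e₀ ∈ disc h`
on `H`): `Σ_{h ∈ H} m_h·e^{Φ_h} ≤ Menv·Σ_{Q ⊆ E} 𝟙[e₀ ∈ Q]·exp(B Q + ζ Q)`. [cite: Balaban1985UV3, (41) p.266, pp.273–274] -/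
theorem sum_mul_exp_le_of_envelope_pinned (H : Finset ι) (E : Finset β) (adm : ι → Prop) [DecidablePred adm] (disc : ι → Finset β)
    (hdiscE : ∀ h ∈ H, adm h → disc h ⊆ E) (hinj : Set.InjOn disc {h | h ∈ H ∧ adm h})
    (m Φ : ι → ℝ) (B ζ : Finset β → ℝ) {Menv : ℝ} (hMenv : 0 ≤ Menv)
    (hm_adm : ∀ h ∈ H, ¬ adm h → m h = 0)
    (hmE : ∀ h ∈ H, adm h → m h ≤ Menv * Real.exp (ζ (disc h)))
    (hΦ : ∀ h ∈ H, adm h → Φ h ≤ B (disc h)) {e₀ : β} (hpin : ∀ h ∈ H, adm h → e₀ ∈ disc h) :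
    ∑ h ∈ H, m h * Real.exp (Φ h) ≤ Menv * ∑ Q ∈ E.powerset, (if e₀ ∈ Q then Real.exp (B Q + ζ Q) else 0) := by
  classical
  refine (sum_mul_exp_le_sum_image H adm disc hinj m Φ B ζ hMenv hm_adm hmE hΦ).trans ?_
  -- on the image every `Q` contains `e₀`, so the summand IS the pinned summand
  have h3 : ∑ Q ∈ (H.filter adm).image disc, Menv * Real.exp (B Q + ζ Q)
      = ∑ Q ∈ (H.filter adm).image disc, Menv * (if e₀ ∈ Q then Real.exp (B Q + ζ Q) else 0) := by
    refine Finset.sum_congr rfl fun Q hQ => ?_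
    obtain ⟨h, hh, rfl⟩ := Finset.mem_image.mp hQ
    rw [Finset.mem_filter] at hh
    rw [if_pos (hpin h hh.1 hh.2)]
  rw [h3, Finset.mul_sum]
  refine Finset.sum_le_sum_of_subset_of_nonneg ?_ fun Q _ _ => mul_nonneg hMenv ?_
  · intro Q hQ
    obtain ⟨h, hh, rfl⟩ := Finset.mem_image.mp hQ
    rw [Finset.mem_filter] at hh
    exact Finset.mem_powerset.mpr (hdiscE h hh.1 hh.2)
  · split_ifs
    · exact (Real.exp_pos _).le
    · exact le_rfl

end Finitary

/-! ## §2 The interior at one level: per-history net exponent, scale entropy -/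

section Interior

variable {β : Type*}

/-- ★ **THE NET EXPONENT OF A DISCRETE HISTORY** (interior of lit ✓`largeFieldControl_of_resummation`, one level `k`): with `x_j = x(g_j)` satisfying `x_j ≥ 1`, antitone on the
window and `x_i − x_k = (k − i)ℓ`, the gain `c₁(b₀x_i^{p₀})²∕4` per source `(i, p′) ∈ Q`, the volume rates `A x_j + A₀` paid on the counted collars (`zvol_j(Q) ≤ Σ_{(i,p′) ∈ Q, i ≤ j}
(c_gρ)³x_i^{3r₀}`), and the provisos `3r₀ + 2 ≤ 2p₀`, `8(A + A₀)(c_gρ)³∕ℓ ≤ c₁b₀²`: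
`−Σ_{e∈Q} gain_e + Σ_{j<k} A x_j·zvol_j(Q) + A₀·Σ_{j<k} zvol_j(Q) ≤ Σ_{e∈Q} −(c₁∕8)(b₀x_{e.1}^{p₀})²` (lit `exchange_sum`, `perSource_net_le`).
[cite: Balaban1985UV3, (41) p.266, (39) p.266, (71) p.273] -/
theorem net_exponent_le {A A₀ c₁ b₀ p₀ r₀ cρ ℓ : ℝ} {x : ℕ → ℝ} {k : ℕ}
    (hA : 0 ≤ A) (hA₀ : 0 ≤ A₀) (hc : 0 ≤ cρ) (hℓ : 0 < ℓ)
    (hone : ∀ j, j ≤ k → 1 ≤ x j) (hmono : ∀ i j, i ≤ j → j ≤ k → x j ≤ x i)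
    (hdiff : ∀ i, i ≤ k → x i - x k = ((k - i : ℕ) : ℝ) * ℓ)
    (hp : r₀ * 3 + 2 ≤ 2 * p₀) (hb : 8 * ((A + A₀) * cρ ^ 3 / ℓ) ≤ c₁ * b₀ ^ 2)
    (zvol : ℕ → Finset (ℕ × β) → ℝ) (Q : Finset (ℕ × β)) (hQ : ∀ e ∈ Q, e.1 < k)
    (hV : ∀ j, j < k → zvol j Q ≤ ∑ e ∈ Q.filter (fun e => e.1 ≤ j), cρ ^ 3 * x e.1 ^ (3 * r₀)) :
    -(∑ e ∈ Q, c₁ * (b₀ * x e.1 ^ p₀) ^ 2 / 4) + ∑ j ∈ Finset.range k, A * x j * zvol j Q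
        + A₀ * ∑ j ∈ Finset.range k, zvol j Q
      ≤ ∑ e ∈ Q, -(c₁ * (b₀ * x e.1 ^ p₀) ^ 2 / 8) := by
  classical
  have hz : ∀ j ∈ Finset.range k, (A * x j + A₀) * zvol j Q
      ≤ (A * x j + A₀) * ∑ e ∈ Q.filter (fun e => e.1 ≤ j), cρ ^ 3 * x e.1 ^ (3 * r₀) := by
    intro j hj
    rw [Finset.mem_range] at hj
    have hxj : 1 ≤ x j := hone j hj.le
    have hrate : 0 ≤ A * x j + A₀ := by nlinarith
    exact mul_le_mul_of_nonneg_left (hV j hj) hrate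
  have step1 : -(∑ e ∈ Q, c₁ * (b₀ * x e.1 ^ p₀) ^ 2 / 4) + ∑ j ∈ Finset.range k, A * x j * zvol j Q
        + A₀ * ∑ j ∈ Finset.range k, zvol j Q
      = -(∑ e ∈ Q, c₁ * (b₀ * x e.1 ^ p₀) ^ 2 / 4) + ∑ j ∈ Finset.range k, (A * x j + A₀) * zvol j Q := by
    rw [Finset.mul_sum, add_assoc, ← Finset.sum_add_distrib]
    congr 1
    refine Finset.sum_congr rfl fun j _ => ?_
    ring
  have step2 : ∑ j ∈ Finset.range k, (A * x j + A₀) * ∑ e ∈ Q.filter (fun e => e.1 ≤ j), cρ ^ 3 * x e.1 ^ (3 * r₀)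
      = ∑ e ∈ Q, cρ ^ 3 * x e.1 ^ (3 * r₀) * ∑ j ∈ (Finset.range k).filter (fun j => e.1 ≤ j), (A * x j + A₀) :=
    exchange_sum Q k (fun j => A * x j + A₀) (fun e => cρ ^ 3 * x e.1 ^ (3 * r₀))
  have step3 : ∀ e ∈ Q, -(c₁ * (b₀ * x e.1 ^ p₀) ^ 2 / 4)
      + cρ ^ 3 * x e.1 ^ (3 * r₀) * ∑ j ∈ (Finset.range k).filter (fun j => e.1 ≤ j), (A * x j + A₀)
        ≤ -(c₁ * (b₀ * x e.1 ^ p₀) ^ 2 / 8) := by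
    intro e he
    have hik : e.1 < k := hQ e he
    exact perSource_net_le (x := x) hA hA₀ hc hℓ hik hone (fun j hij hj => hmono e.1 j hij hj) (hdiff e.1 hik.le) hp hb
  calc -(∑ e ∈ Q, c₁ * (b₀ * x e.1 ^ p₀) ^ 2 / 4) + ∑ j ∈ Finset.range k, A * x j * zvol j Q
          + A₀ * ∑ j ∈ Finset.range k, zvol j Q
      = -(∑ e ∈ Q, c₁ * (b₀ * x e.1 ^ p₀) ^ 2 / 4) + ∑ j ∈ Finset.range k, (A * x j + A₀) * zvol j Q := step1
    _ ≤ -(∑ e ∈ Q, c₁ * (b₀ * x e.1 ^ p₀) ^ 2 / 4)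
          + ∑ j ∈ Finset.range k, (A * x j + A₀) * ∑ e ∈ Q.filter (fun e => e.1 ≤ j), cρ ^ 3 * x e.1 ^ (3 * r₀) := by
        linarith [Finset.sum_le_sum hz]
    _ = -(∑ e ∈ Q, c₁ * (b₀ * x e.1 ^ p₀) ^ 2 / 4)
          + ∑ e ∈ Q, cρ ^ 3 * x e.1 ^ (3 * r₀) * ∑ j ∈ (Finset.range k).filter (fun j => e.1 ≤ j), (A * x j + A₀) := by
        rw [step2]
    _ = ∑ e ∈ Q, (-(c₁ * (b₀ * x e.1 ^ p₀) ^ 2 / 4)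
          + cρ ^ 3 * x e.1 ^ (3 * r₀) * ∑ j ∈ (Finset.range k).filter (fun j => e.1 ≤ j), (A * x j + A₀)) := by
        rw [Finset.sum_add_distrib, Finset.sum_neg_distrib]
    _ ≤ ∑ e ∈ Q, -(c₁ * (b₀ * x e.1 ^ p₀) ^ 2 / 8) := Finset.sum_le_sum step3

/-- ★ **THE SURVIVING FACTOR AT SCALE `i` IS AT MOST `e^{−κx_i}`, `κ = c₁b₀²∕8`** (`x ≥ 1`, `2p₀ ≥ 1`). [cite: Balaban1985UV3, (71) p.273, (7) p.257] -/
theorem exp_theta_le {c₁ b₀ p₀ x : ℝ} (hc₁ : 0 ≤ c₁) (hx : 1 ≤ x) (hp : 1 ≤ 2 * p₀) :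
    Real.exp (-(c₁ * (b₀ * x ^ p₀) ^ 2 / 8)) ≤ Real.exp (-(c₁ * b₀ ^ 2 / 8 * x)) := by
  have hx0 : 0 ≤ x := by linarith
  have hκ : 0 ≤ c₁ * b₀ ^ 2 / 8 := by positivity
  apply Real.exp_le_exp.mpr
  have h2 : (x ^ p₀) ^ 2 = x ^ (2 * p₀) := by
    rw [mul_comm, Real.rpow_mul hx0, Real.rpow_two]
  have h3 : x ≤ x ^ (2 * p₀) := by
    have := Real.rpow_le_rpow_of_exponent_le hx hp
    rwa [Real.rpow_one] at this
  have h4 : c₁ * b₀ ^ 2 / 8 * x ≤ c₁ * b₀ ^ 2 / 8 * (x ^ p₀) ^ 2 := by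
    rw [h2]
    exact mul_le_mul_of_nonneg_left h3 hκ
  rw [mul_pow]
  linarith

/-- ★ **THE SCALE ENTROPY AT ONE LEVEL**: with at most `3e^{σ(k−j)}S` candidates of scale `j < k` and `x_j ≥ 1 + (k − j)ℓ`, `8(σ + ℓ) ≤ c₁b₀²ℓ`,
`Σ_{e ∈ E} exp(−(c₁∕8)(b₀x_{e.1}^{p₀})²) ≤ (3∕ℓ)·S` (lit `scaleEntropy_sum_le`). [cite: Balaban1985UV3, (5) p.256, (71) p.273] -/
theorem sum_exp_theta_le {c₁ b₀ p₀ σ ℓ S : ℝ} {x : ℕ → ℝ} {k : ℕ} (E : Finset (ℕ × β))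
    (hE : ∀ e ∈ E, e.1 < k)
    (hcardE : ∀ j, j < k → (((E.filter (fun e => e.1 = j)).card : ℝ) ≤ 3 * Real.exp (σ * ((k - j : ℕ) : ℝ)) * S))
    (hc₁ : 0 ≤ c₁) (hℓ : 0 < ℓ) (hS : 0 ≤ S) (hp : 1 ≤ 2 * p₀)
    (hone : ∀ j, j ≤ k → 1 ≤ x j) (hxj : ∀ j, j < k → 1 + ((k - j : ℕ) : ℝ) * ℓ ≤ x j)
    (hb₂ : 8 * (σ + ℓ) ≤ c₁ * b₀ ^ 2 * ℓ) :
    ∑ e ∈ E, Real.exp (-(c₁ * (b₀ * x e.1 ^ p₀) ^ 2 / 8)) ≤ 3 / ℓ * S := by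
  classical
  have hκ : 0 ≤ c₁ * b₀ ^ 2 / 8 := by positivity
  have hκℓ : σ + ℓ ≤ c₁ * b₀ ^ 2 / 8 * ℓ := by linarith
  have hθ : ∀ e ∈ E, Real.exp (-(c₁ * (b₀ * x e.1 ^ p₀) ^ 2 / 8)) ≤ Real.exp (-(c₁ * b₀ ^ 2 / 8 * x e.1)) :=
    fun e he => exp_theta_le hc₁ (hone e.1 (hE e he).le) hp
  -- count the candidates scale by scale
  have hmaps : ∀ e ∈ E, e.1 ∈ Finset.range k := fun e he => Finset.mem_range.mpr (hE e he)
  have hcount : ∑ e ∈ E, Real.exp (-(c₁ * b₀ ^ 2 / 8 * x e.1))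
      ≤ ∑ j ∈ Finset.range k, 3 * Real.exp (σ * ((k - j : ℕ) : ℝ)) * S * Real.exp (-(c₁ * b₀ ^ 2 / 8 * x j)) := by
    rw [← Finset.sum_fiberwise_of_maps_to hmaps]
    refine Finset.sum_le_sum fun j hj => ?_
    have hfib : ∑ e ∈ E.filter (fun e => e.1 = j), Real.exp (-(c₁ * b₀ ^ 2 / 8 * x e.1))
        = ∑ e ∈ E.filter (fun e => e.1 = j), Real.exp (-(c₁ * b₀ ^ 2 / 8 * x j)) :=
      Finset.sum_congr rfl fun e he => by rw [(Finset.mem_filter.mp he).2]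
    rw [hfib, Finset.sum_const, nsmul_eq_mul]
    exact mul_le_mul_of_nonneg_right (hcardE j (Finset.mem_range.mp hj)) (Real.exp_pos _).le
  calc ∑ e ∈ E, Real.exp (-(c₁ * (b₀ * x e.1 ^ p₀) ^ 2 / 8))
      ≤ ∑ e ∈ E, Real.exp (-(c₁ * b₀ ^ 2 / 8 * x e.1)) := Finset.sum_le_sum hθ
    _ ≤ ∑ j ∈ Finset.range k, 3 * Real.exp (σ * ((k - j : ℕ) : ℝ)) * S * Real.exp (-(c₁ * b₀ ^ 2 / 8 * x j)) := hcount
    _ ≤ 3 * S / ℓ := scaleEntropy_sum_le x k hℓ hS hκ hκℓ hxj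
    _ = 3 / ℓ * S := by ring

end Interior

/-! ## §3 The resummation at one level under a mass envelope, admissible histories, un-pinned and pinned -/

section Main

variable {ι β : Type*} [DecidableEq β]

/-- ★★★ **THE LARGE-FIELD SUM OF (41) AT ONE LEVEL, MASSES UNDER AN ENVELOPE, ADMISSIBLE HISTORIES — UN-PINNED AND PINNED.**  Data at level `k ≤ K` of a run with
couplings `g_j` (`0 < g_j ≤ g̃ ≤ 1` for `j ≤ K`, progression `x(g_j) = x_K + (K − j)ℓ`): a finite family `H` of histories with real masses `m_h` that VANISH off the
admissible ones and satisfy the ENVELOPE `m_h ≤ Menv·exp(A₀·Σ_{j<k} zvol_j(disc h))` on the admissible ones; an injective (on the admissible members of `H`) large-field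
record `disc h ⊆ E` into the candidates `E` of scales `< k`, at most `3e^{σ(k−j)}S` per scale `j`; on ADMISSIBLE histories the small factors (67)–(71)
`c₁·Σ_{e∈disc h} p(g_{e.1})²∕4 ≤ mainT_h` and the volume terms `Zterm_h ≤ Σ_{j<k} A·x(g_j)·zvol_j(disc h)`; the counted collar cover `zvol_j(Q) ≤ Σ_{(i,p′)∈Q, i≤j}
(c_gρ)³x(g_i)^{3r₀}` for `Q ⊆ E`; the provisos `3r₀ + 2 ≤ 2p₀`, `8(A + A₀)(c_gρ)³∕ℓ ≤ c₁b₀²`, `8(σ + ℓ) ≤ c₁b₀²ℓ`.  THEN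
(U) `Σ_{h∈H} m_h·exp(−mainT_h + Zterm_h) ≤ Menv·exp((3∕ℓ)S)`, and (P) for every candidate `e₀ ∈ E` through which every admissible member of `H` passes
(`adm h → e₀ ∈ disc h`): `Σ_{h∈H} m_h·exp(−mainT_h + Zterm_h) ≤ Menv·exp(−(c₁∕8)·p(g_{e₀.1})²)·exp((3∕ℓ)S)`.  The interior is lit ✓`largeFieldControl_of_resummation`'s
(pinned: ✓`largeField_pinned_of_resummation`'s) with `HistModel.dominated` replaced by §1's envelope domination. [cite: Balaban1985UV3, (41) p.266, (39) p.266, (67)–(71) p.273, pp.273–274, (7) p.257; Balaban1982Higgs2, §3.C] -/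
theorem largeField_enveloped_adm
    {K k : ℕ} (hk : k ≤ K) (g : ℕ → ℝ) {b₀ p₀ A A₀ c₁ gs cg ρ r₀ ℓ xK S σ Menv : ℝ}
    (E : Finset (ℕ × β)) (hE : ∀ e ∈ E, e.1 < k)
    (hcardE : ∀ j, j < k → (((E.filter (fun e => e.1 = j)).card : ℝ) ≤ 3 * Real.exp (σ * ((k - j : ℕ) : ℝ)) * S))
    (H : Finset ι) (adm : ι → Prop) [DecidablePred adm] (disc : ι → Finset (ℕ × β))
    (hdiscE : ∀ h ∈ H, adm h → disc h ⊆ E) (hinj : Set.InjOn disc {h | h ∈ H ∧ adm h})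
    (m mainT Zterm : ι → ℝ) (zvol : ℕ → Finset (ℕ × β) → ℝ)
    (hMenv : 0 ≤ Menv) (hm_adm : ∀ h ∈ H, ¬ adm h → m h = 0)
    (hmE : ∀ h ∈ H, adm h → m h ≤ Menv * Real.exp (A₀ * ∑ j ∈ Finset.range k, zvol j (disc h)))
    (hSF : ∀ h ∈ H, adm h → c₁ * ∑ e ∈ disc h, B10.pFun b₀ p₀ (g e.1) ^ 2 / 4 ≤ mainT h)
    (hZ : ∀ h ∈ H, adm h → Zterm h ≤ ∑ j ∈ Finset.range k, A * xlog (g j) * zvol j (disc h))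
    (hV : ∀ Q, Q ⊆ E → ∀ j, j < k → zvol j Q ≤ ∑ e ∈ Q.filter (fun e => e.1 ≤ j), (cg * ρ) ^ 3 * xlog (g e.1) ^ (3 * r₀))
    (hA : 0 ≤ A) (hA₀ : 0 ≤ A₀) (hc₁ : 0 ≤ c₁) (hcg : 0 ≤ cg * ρ) (hr : 0 ≤ r₀) (hℓ : 0 < ℓ) (hS : 0 ≤ S)
    (hg : ∀ j, j ≤ K → 0 < g j ∧ g j ≤ gs) (hgs : gs ≤ 1)
    (hx : ∀ j, j ≤ K → xlog (g j) = xK + ((K - j : ℕ) : ℝ) * ℓ)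
    (hp : r₀ * 3 + 2 ≤ 2 * p₀) (hb₁ : 8 * ((A + A₀) * (cg * ρ) ^ 3 / ℓ) ≤ c₁ * b₀ ^ 2) (hb₂ : 8 * (σ + ℓ) ≤ c₁ * b₀ ^ 2 * ℓ) :
    (∑ h ∈ H, m h * Real.exp (-(mainT h) + Zterm h) ≤ Menv * Real.exp (3 / ℓ * S)) ∧
    ∀ e₀ ∈ E, (∀ h ∈ H, adm h → e₀ ∈ disc h) →
      ∑ h ∈ H, m h * Real.exp (-(mainT h) + Zterm h) ≤
        Menv * Real.exp (-(c₁ / 8 * B10.pFun b₀ p₀ (g e₀.1) ^ 2)) * Real.exp (3 / ℓ * S) := by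
  classical
  -- the unit `x_j = 1 + log g_j⁻¹` along the run
  set x : ℕ → ℝ := fun j => xlog (g j) with hxdef
  have hx1 : ∀ j, j ≤ K → 1 ≤ x j := fun j hj => one_le_xlog (hg j hj).1 ((hg j hj).2.trans hgs)
  have hxmono : ∀ i j, i ≤ j → j ≤ K → x j ≤ x i := by
    intro i j hij hj
    show xlog (g j) ≤ xlog (g i)
    rw [hx i (hij.trans hj), hx j hj]
    have : ((K - j : ℕ) : ℝ) ≤ ((K - i : ℕ) : ℝ) := by exact_mod_cast Nat.sub_le_sub_left hij _
    nlinarith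
  have hxdiff : ∀ i, i ≤ k → x i - x k = ((k - i : ℕ) : ℝ) * ℓ := by
    intro i hi
    show xlog (g i) - xlog (g k) = ((k - i : ℕ) : ℝ) * ℓ
    rw [hx i (hi.trans hk), hx k hk]
    have hcast : ((K - i : ℕ) : ℝ) = ((K - k : ℕ) : ℝ) + ((k - i : ℕ) : ℝ) := by
      rw [← Nat.cast_add]
      congr 1
      omega
    rw [hcast]
    ring
  have hp1 : 1 ≤ 2 * p₀ := by linarith
  have hxj : ∀ j, j < k → 1 + ((k - j : ℕ) : ℝ) * ℓ ≤ x j := by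
    intro j hj
    have := hxdiff j hj.le
    have := hx1 k hk
    linarith
  -- per-source gain and surviving exponent, the bounding function of the discrete data and the mass allowance
  let gain : ℕ × β → ℝ := fun e => c₁ * (b₀ * x e.1 ^ p₀) ^ 2 / 4
  let θ : ℕ × β → ℝ := fun e => -(c₁ * (b₀ * x e.1 ^ p₀) ^ 2 / 8)
  let B : Finset (ℕ × β) → ℝ := fun Q => -(∑ e ∈ Q, gain e) + ∑ j ∈ Finset.range k, A * x j * zvol j Q
  let ζ : Finset (ℕ × β) → ℝ := fun Q => A₀ * ∑ j ∈ Finset.range k, zvol j Q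
  -- the exponent of an admissible history is at most `B` of its record
  have hΦ : ∀ h ∈ H, adm h → -(mainT h) + Zterm h ≤ B (disc h) := by
    intro h hh ha
    have h1 := hSF h hh ha
    have h2 := hZ h hh ha
    have h3 : c₁ * ∑ e ∈ disc h, B10.pFun b₀ p₀ (g e.1) ^ 2 / 4 = ∑ e ∈ disc h, gain e := by
      rw [Finset.mul_sum]
      refine Finset.sum_congr rfl fun e _ => ?_
      simp only [gain, pFun_eq, hxdef]
      ring
    show -(mainT h) + Zterm h ≤ -(∑ e ∈ disc h, gain e) + ∑ j ∈ Finset.range k, A * x j * zvol j (disc h)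
    linarith
  -- each discrete history's summand is at most the product of the surviving factors of its sources
  have hsummand : ∀ Q ∈ E.powerset, Real.exp (B Q + ζ Q) ≤ Real.exp (∑ e ∈ Q, θ e) := by
    intro Q hQ
    rw [Finset.mem_powerset] at hQ
    apply Real.exp_le_exp.mpr
    have hQlt : ∀ e ∈ Q, e.1 < k := fun e he => hE e (hQ he)
    have := net_exponent_le (x := x) hA hA₀ hcg hℓ (fun j hj => hx1 j (hj.trans hk))
      (fun i j hij hj => hxmono i j hij (hj.trans hk)) hxdiff hp hb₁ zvol Q hQlt (fun j hj => hV Q hQ j hj)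
    show -(∑ e ∈ Q, gain e) + ∑ j ∈ Finset.range k, A * x j * zvol j Q + A₀ * ∑ j ∈ Finset.range k, zvol j Q
      ≤ ∑ e ∈ Q, θ e
    exact this
  -- the scale entropy
  have hfinal : ∑ e ∈ E, Real.exp (θ e) ≤ 3 / ℓ * S :=
    sum_exp_theta_le (x := x) E hE hcardE hc₁ hℓ hS hp1 (fun j hj => hx1 j (hj.trans hk)) hxj hb₂
  refine ⟨?_, fun e₀ he₀ hpin => ?_⟩
  · -- (U) un-pinned
    calc ∑ h ∈ H, m h * Real.exp (-(mainT h) + Zterm h)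
        ≤ Menv * ∑ Q ∈ E.powerset, Real.exp (B Q + ζ Q) :=
          sum_mul_exp_le_of_envelope H E adm disc hdiscE hinj m (fun h => -(mainT h) + Zterm h) B ζ hMenv hm_adm hmE hΦ
      _ ≤ Menv * ∑ Q ∈ E.powerset, Real.exp (∑ e ∈ Q, θ e) :=
          mul_le_mul_of_nonneg_left (Finset.sum_le_sum hsummand) hMenv
      _ ≤ Menv * Real.exp (∑ e ∈ E, Real.exp (θ e)) :=
          mul_le_mul_of_nonneg_left (sum_powerset_exp_sum_le _ θ) hMenv
      _ ≤ Menv * Real.exp (3 / ℓ * S) := mul_le_mul_of_nonneg_left (Real.exp_le_exp.mpr hfinal) hMenv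
  · -- (P) pinned at `e₀`
    have hsummand' : ∀ Q ∈ E.powerset,
        (if e₀ ∈ Q then Real.exp (B Q + ζ Q) else 0) ≤ (if e₀ ∈ Q then Real.exp (∑ e ∈ Q, θ e) else 0) := by
      intro Q hQ
      split_ifs
      · exact hsummand Q hQ
      · exact le_rfl
    have hθe₀ : Real.exp (θ e₀) = Real.exp (-(c₁ / 8 * B10.pFun b₀ p₀ (g e₀.1) ^ 2)) := by
      congr 1
      simp only [θ, pFun_eq, hxdef]
      ring
    calc ∑ h ∈ H, m h * Real.exp (-(mainT h) + Zterm h)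
        ≤ Menv * ∑ Q ∈ E.powerset, (if e₀ ∈ Q then Real.exp (B Q + ζ Q) else 0) :=
          sum_mul_exp_le_of_envelope_pinned H E adm disc hdiscE hinj m (fun h => -(mainT h) + Zterm h) B ζ hMenv hm_adm
            hmE hΦ hpin
      _ ≤ Menv * ∑ Q ∈ E.powerset, (if e₀ ∈ Q then Real.exp (∑ e ∈ Q, θ e) else 0) :=
          mul_le_mul_of_nonneg_left (Finset.sum_le_sum hsummand') hMenv
      _ ≤ Menv * (Real.exp (θ e₀) * Real.exp (∑ e ∈ E, Real.exp (θ e))) :=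
          mul_le_mul_of_nonneg_left (sum_powerset_ite_mem_exp_sum_le E θ he₀) hMenv
      _ ≤ Menv * (Real.exp (θ e₀) * Real.exp (3 / ℓ * S)) :=
          mul_le_mul_of_nonneg_left (mul_le_mul_of_nonneg_left (Real.exp_le_exp.mpr hfinal) (Real.exp_pos _).le) hMenv
      _ = Menv * Real.exp (-(c₁ / 8 * B10.pFun b₀ p₀ (g e₀.1) ^ 2)) * Real.exp (3 / ℓ * S) := by rw [hθe₀]; ring

end Main

end Summit.QuantumFields.YangMills.Theorems.UV3LargeFieldEnvelopedResummation
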